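import Summits.AtomisticToContinuum.Crystallization.Theorems.OverbindingBudgetBalancedLayered

/-!
# OverbindingBudget — the compressed virial law by DISCHARGING: a per-site virial floor up to bounded antisymmetric transfers (lens-4 g28, part XIV)

Helper file (`--supports stmt-AtomisticToContinuum-31280`).  Slot 3 of the RDEF cone is the EOS branch `CompressedVirialLaw T₀ D` (a texture of
the clean class with a COMPRESSED clean scale `a ≤ 189/200` has dilation-strained cubes).  Its per-site sufficient condition
`LocalVirialLaw T₀ D` (`…ElasticSplitLocalVirial`: every site has virial `≥ c > 0` against every finite part of the texture containing its unit
ball) was measured by census TAG 155 (kit j343688, `VIR155.md` on stmt-31280): NOT crossed, but MARGIN ≈ 0 at the uncompressed end — the adversary is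
ONE dilated-shell site (its twelve at the outer `RT` edge `1.0242a`, outer shells pulled in) whose over-compressed neighbours re-gain on average
(cube-AVERAGED margin `+0.389`, TAG 147 (a)); a per-site certificate cannot close on separation-only tails.  This file types the standard repair —
DISCHARGING — and proves its seam:

* `LocalVirialInequalityT T₀ D c τ₁` (§1): on every compressed clean texture there is an ANTISYMMETRIC transfer `τ : E3 → E3 → ℝ`
  (`τ y w = −τ w y`) whose partial sums at a site are `≥ −τ₁` and such that the DISCHARGED site virial `siteVirial y G + Σ_{w ∈ G} τ y w` is
  `≥ c` against every finite `G ⊆ Y` containing the unit ball of `y`; `LocalVirialLawT T₀ D := ∃ c > 0, ∃ τ₁ ≥ 0, …`.  WEAKER than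
  `LocalVirialLaw` (`localVirialLawT_of_localVirialLaw`, `τ = 0`); INSTRUMENTABLE·CERT (census: a bond-local transfer rule moving virial from
  over-compressed sites to their dilated-shell neighbours; the decision number is the min of the DISCHARGED per-site virial). [piece]
* `sum_sum_transfer_eq_zero` (§1): antisymmetric transfers cancel inside every chunk — so discharging costs NOTHING in the cube average.
* `compressedVirialLaw_of_localVirialT` (§2, PROVED): `LocalVirialInequalityT T₀ D c τ₁ → CompressedVirialLaw T₀ D` (`c > 0`, `τ₁ ≥ 0`) — the
  bookkeeping of `compressedVirialLaw_of_localVirial` verbatim with the shallow-site floor `−250 δ⁻⁶` lowered by `τ₁`.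
* CONE `rdef_of_grossU_doorPeriodic_discharged Λ` (§2): the ninth form with `LocalVirialLawT (1/250) 10` in slot 3.
-/

namespace Summit.AtomisticToContinuum.Crystallization.Theorems.OverbindingBudgetLocalVirialTransfer

open scoped BigOperators Classical
open Literature.MathematicalPhysics.StatisticalMechanics (UniformlyDiscrete sum_inv_pow_six_le)
open Summit.AtomisticToContinuum.Crystallization.Theses.OverbindingBudget (RobustDefectLimitWindows)
open Summit.AtomisticToContinuum.Crystallization.Theses.PricedLinkCensus (ChargedEnergyGap)
open Summit.AtomisticToContinuum.Crystallization.Theorems.OverbindingBudgetGradedBareness (CleanlessExcessT)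
open Summit.AtomisticToContinuum.Crystallization.Theorems.OverbindingBudgetCoherentCut (CoherentResidual)
open Summit.AtomisticToContinuum.Crystallization.Theorems.OverbindingBudgetUniformCutStatements (GrossCleanBallsU)
open Summit.AtomisticToContinuum.Crystallization.Theorems.OverbindingBudgetCubeTails (card_le_of_separated_of_box)
open Summit.AtomisticToContinuum.Crystallization.Theorems.OverbindingBudgetExcessInstability (finite_inter_cube)
open Summit.AtomisticToContinuum.Crystallization.Theorems.OverbindingBudgetEdgeRelaxationStatements (CleanClass)
open Summit.AtomisticToContinuum.Crystallization.Theorems.OverbindingBudgetElasticSplitStatements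
open Summit.AtomisticToContinuum.Crystallization.Theorems.OverbindingBudgetElasticSplitDilation (enum enum_injective sum_sum_enum)
open Summit.AtomisticToContinuum.Crystallization.Theorems.OverbindingBudgetElasticSplitScale
open Summit.AtomisticToContinuum.Crystallization.Theorems.OverbindingBudgetElasticSplitLocalVirial (siteVirial LocalVirialInequality LocalVirialLaw
  invPowSum_sub_eq_sum_siteVirial siteVirial_ge invPowSum_twelve_le card_shallow_le le_card_deep)
open Summit.AtomisticToContinuum.Crystallization.Theorems.OverbindingBudgetElasticSplitDoorBridge (CleanCharted)
open Summit.AtomisticToContinuum.Crystallization.Theorems.ChartedPlanarOrderDoorLayered (DoorPeriodic)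
open Summit.AtomisticToContinuum.Crystallization.Theorems.OverbindingBudgetTightDozen (TightDozenRigidity)
open Summit.AtomisticToContinuum.Crystallization.Theorems.OverbindingBudgetBalancedLayered (BalancedLayeredClean rdef_of_grossU_doorPeriodic_balanced)

/-! ## §1 The discharged per-site law -/

/-- **`LocalVirialInequalityT T₀ D c τ₁`** — the per-site virial floor `c` UP TO ANTISYMMETRIC TRANSFERS with partial sums `≥ −τ₁`. [piece] -/
def LocalVirialInequalityT (T₀ D c τ₁ : ℝ) : Prop :=
  ∀ Y : Set (EuclideanSpace ℝ (Fin 3)), CleanClass T₀ D Y → HasCompressedScale T₀ Y →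
    ∃ τ : EuclideanSpace ℝ (Fin 3) → EuclideanSpace ℝ (Fin 3) → ℝ, (∀ y w, τ y w = -τ w y) ∧
      (∀ y ∈ Y, ∀ G : Finset (EuclideanSpace ℝ (Fin 3)), (↑G : Set (EuclideanSpace ℝ (Fin 3))) ⊆ Y → -τ₁ ≤ ∑ w ∈ G, τ y w) ∧
      ∀ y ∈ Y, ∀ G : Finset (EuclideanSpace ℝ (Fin 3)), (↑G : Set (EuclideanSpace ℝ (Fin 3))) ⊆ Y →
        (∀ w ∈ Y, dist y w ≤ 1 → w ∈ G) → c ≤ siteVirial y G + ∑ w ∈ G, τ y w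

/-- **`LocalVirialLawT T₀ D`** := `∃ c > 0, ∃ τ₁ ≥ 0, LocalVirialInequalityT T₀ D c τ₁` — the DISCHARGED per-site virial law; WEAKER than
`LocalVirialLaw T₀ D`, KERNEL-STRONGER than `CompressedVirialLaw T₀ D`. INSTRUMENTABLE·CERT. [piece] -/
def LocalVirialLawT (T₀ D : ℝ) : Prop :=
  ∃ c : ℝ, 0 < c ∧ ∃ τ₁ : ℝ, 0 ≤ τ₁ ∧ LocalVirialInequalityT T₀ D c τ₁

/-- The undischarged law is the case `τ = 0`. [this file] -/
theorem localVirialT_of_local {T₀ D c : ℝ} (h : LocalVirialInequality T₀ D c) : LocalVirialInequalityT T₀ D c 0 := by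
  intro Y hY hcs
  refine ⟨fun _ _ => 0, fun _ _ => by simp, fun y _ G _ => by simp, fun y hy G hG hB => ?_⟩
  simpa using h Y hY hcs y hy G hG hB

/-- `LocalVirialLaw → LocalVirialLawT`. [this file] -/
theorem localVirialLawT_of_localVirialLaw {T₀ D : ℝ} (h : LocalVirialLaw T₀ D) : LocalVirialLawT T₀ D := by
  obtain ⟨c, hc, h⟩ := h
  exact ⟨c, hc, 0, le_rfl, localVirialT_of_local h⟩

/-- **Antisymmetric transfers cancel inside every chunk**: `Σ_{y ∈ F} Σ_{w ∈ F} τ y w = 0`. [this file] -/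
theorem sum_sum_transfer_eq_zero {τ : EuclideanSpace ℝ (Fin 3) → EuclideanSpace ℝ (Fin 3) → ℝ} (hanti : ∀ y w, τ y w = -τ w y)
    (F : Finset (EuclideanSpace ℝ (Fin 3))) : ∑ y ∈ F, ∑ w ∈ F, τ y w = 0 := by
  have h : ∑ y ∈ F, ∑ w ∈ F, τ y w = -∑ y ∈ F, ∑ w ∈ F, τ y w := by
    conv_rhs => rw [Finset.sum_comm]
    rw [← Finset.sum_neg_distrib]
    refine Finset.sum_congr rfl fun w _ => ?_
    rw [← Finset.sum_neg_distrib]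
    exact Finset.sum_congr rfl fun y _ => hanti _ _
  linarith

/-! ## §2 The seam and the cone -/

set_option maxHeartbeats 1600000 in
/-- **`LocalVirialInequalityT ⟹ CompressedVirialLaw`** (PROVED bookkeeping): the discharged per-site floor `c > 0` gives cofinal cubes with
dilation gain `≥ κ ℓ³`; the transfers cancel in the cube sum and only lower the shallow-site floor by `τ₁`. [this file] -/
theorem compressedVirialLaw_of_localVirialT {T₀ D c τ₁ : ℝ} (hc : 0 < c) (hτ₁ : 0 ≤ τ₁) (h : LocalVirialInequalityT T₀ D c τ₁) :
    CompressedVirialLaw T₀ D := by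
  intro Y hY hcs
  obtain ⟨τ, hanti, hτb, hlaw⟩ := h Y hY hcs
  obtain ⟨δ₀, hδ₀, hsep₀⟩ := hY.1
  set δ : ℝ := min δ₀ 1 with hδdef
  have hδ : 0 < δ := lt_min hδ₀ one_pos
  have hδ1 : δ ≤ 1 := min_le_right _ _
  have hsep : ∀ p ∈ Y, ∀ p' ∈ Y, p ≠ p' → δ ≤ dist p p' :=
    fun p hp p' hp' hpp' => (min_le_left _ _).trans (hsep₀ p hp p' hp' hpp')
  have hUD : UniformlyDiscrete Y := ⟨δ, hδ, hsep⟩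
  have hcov : ∀ z : EuclideanSpace ℝ (Fin 3), ∃ w ∈ Y, dist z w ≤ 9 / 10 := hY.2.2.2.1
  set A : ℝ := 162 / δ ^ 3 with hA
  set B : ℝ := 27 / δ ^ 3 with hB
  set M₀ : ℝ := 250 * δ⁻¹ ^ 6 with hM₀
  have hM₀pos : 0 < M₀ := by positivity
  set M : ℝ := M₀ + τ₁ with hM
  set Dd : ℝ := 250 * δ⁻¹ ^ 12 * B with hDd
  have hMpos : 0 < M := by rw [hM]; linarith
  have hDpos : 0 < Dd := by positivity
  set κ : ℝ := (c / 128) ^ 2 / (24 * Dd) with hκ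
  refine ⟨κ, by positivity, ?_⟩
  intro ℓ₀
  obtain ⟨m, hm⟩ := exists_nat_ge (max ℓ₀ (max 6 (128 * M * A / c)) / 2)
  set ℓ : ℝ := 2 * (m : ℝ) + 3 with hℓ
  have hmax : max ℓ₀ (max 6 (128 * M * A / c)) ≤ ℓ := by
    have : max ℓ₀ (max 6 (128 * M * A / c)) ≤ 2 * (m : ℝ) := by linarith
    linarith
  have hℓ₀ : ℓ₀ ≤ ℓ := (le_max_left _ _).trans hmax
  have hℓ6 : 6 ≤ ℓ := le_trans (le_trans (le_max_left _ _) (le_max_right _ _)) hmax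
  have hℓA : 128 * M * A / c ≤ ℓ := le_trans (le_trans (le_max_right _ _) (le_max_right _ _)) hmax
  have hℓ1 : 1 ≤ ℓ := by linarith
  have hℓpos : 0 < ℓ := by linarith
  obtain ⟨q, -⟩ : ∃ q : EuclideanSpace ℝ (Fin 3), True := ⟨0, trivial⟩
  have hfin := finite_inter_cube hUD q hℓpos.le
  set F : Finset (EuclideanSpace ℝ (Fin 3)) := hfin.toFinset with hFdef
  have hFcoe : (↑F : Set (EuclideanSpace ℝ (Fin 3))) = Y ∩ {z | ∀ i : Fin 3, q i ≤ z i ∧ z i < q i + ℓ} :=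
    Set.Finite.coe_toFinset hfin
  have hmemF : ∀ z, z ∈ F ↔ z ∈ Y ∧ ∀ i : Fin 3, q i ≤ z i ∧ z i < q i + ℓ := fun z => by
    rw [hFdef, Set.Finite.mem_toFinset]; rfl
  have hFY : ∀ z ∈ F, z ∈ Y := fun z hz => ((hmemF z).1 hz).1
  have hFcube : ∀ z ∈ F, ∀ i : Fin 3, q i ≤ z i ∧ z i < q i + ℓ := fun z hz => ((hmemF z).1 hz).2
  have hFsub : (↑F : Set (EuclideanSpace ℝ (Fin 3))) ⊆ Y := fun z hz => hFY z hz
  have hsepF : ∀ z ∈ F, ∀ z' ∈ F, z ≠ z' → δ ≤ dist z z' := fun z hz z' hz' hzz' => hsep z (hFY z hz) z' (hFY z' hz') hzz'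
  set P : EuclideanSpace ℝ (Fin 3) → Prop := fun z => ∀ i : Fin 3, q i + 1 ≤ z i ∧ z i < q i + ℓ - 1 with hP
  have hdeepV : ∀ y ∈ F.filter P, c ≤ siteVirial y F + ∑ w ∈ F, τ y w := by
    intro y hy
    have hyF : y ∈ F := Finset.mem_of_mem_filter y hy
    have hyP : P y := (Finset.mem_filter.1 hy).2
    refine hlaw y (hFY y hyF) F hFsub fun w' hw' hd => ?_
    rw [hmemF]
    refine ⟨hw', fun i => ?_⟩
    have hi := (PiLp.dist_apply_le y w' i).trans hd
    rw [Real.dist_eq, abs_le] at hi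
    have hy1 := hyP i
    constructor <;> linarith [hi.1, hi.2, hy1.1, hy1.2]
  have hshallowV : ∀ y ∈ F.filter (fun z => ¬ P z), -M ≤ siteVirial y F + ∑ w ∈ F, τ y w := by
    intro y hy
    have hyF : y ∈ F := Finset.mem_of_mem_filter y hy
    have h1 := siteVirial_ge hδ hsepF hyF
    have h2 := hτb y (hFY y hyF) F hFsub
    rw [hM]; linarith
  have hdeepN : (m : ℝ) ^ 3 ≤ ((F.filter P).card : ℝ) := by
    have h3 : (2 * (m : ℝ) + 3) = ℓ := by rw [hℓ]
    have := le_card_deep hcov q m F (fun z hz hzc => (hmemF z).2 ⟨hz, by rw [← h3]; exact hzc⟩)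
    simpa only [h3] using this
  have hshallowN : ((F.filter (fun z => ¬ P z)).card : ℝ) ≤ A * ℓ ^ 2 := by
    have := card_shallow_le hδ hδ1 hℓ1 hFcube hsepF
    rw [hA]
    calc ((F.filter (fun z => ¬ P z)).card : ℝ) ≤ 162 * ℓ ^ 2 / δ ^ 3 := this
      _ = 162 / δ ^ 3 * ℓ ^ 2 := by ring
  have hS : invPowSum 12 F - invPowSum 6 F = ∑ y ∈ F, (siteVirial y F + ∑ w ∈ F, τ y w) := by
    rw [invPowSum_sub_eq_sum_siteVirial F, Finset.sum_add_distrib, sum_sum_transfer_eq_zero hanti F, add_zero]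
  have hsplit : ∑ y ∈ F, (siteVirial y F + ∑ w ∈ F, τ y w) =
      ∑ y ∈ F.filter P, (siteVirial y F + ∑ w ∈ F, τ y w) + ∑ y ∈ F.filter (fun z => ¬ P z), (siteVirial y F + ∑ w ∈ F, τ y w) :=
    (Finset.sum_filter_add_sum_filter_not F P _).symm
  have hdeepS : ((F.filter P).card : ℝ) * c ≤ ∑ y ∈ F.filter P, (siteVirial y F + ∑ w ∈ F, τ y w) := by
    have := Finset.card_nsmul_le_sum (F.filter P) (fun y => siteVirial y F + ∑ w ∈ F, τ y w) c hdeepV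
    rwa [nsmul_eq_mul] at this
  have hshallowS : ((F.filter (fun z => ¬ P z)).card : ℝ) * (-M) ≤
      ∑ y ∈ F.filter (fun z => ¬ P z), (siteVirial y F + ∑ w ∈ F, τ y w) := by
    have := Finset.card_nsmul_le_sum (F.filter (fun z => ¬ P z)) (fun y => siteVirial y F + ∑ w ∈ F, τ y w) (-M) hshallowV
    rwa [nsmul_eq_mul] at this
  have hm4 : ℓ / 4 ≤ (m : ℝ) := by rw [hℓ] at hℓ6 ⊢; linarith
  have hm3 : ℓ ^ 3 / 64 ≤ (m : ℝ) ^ 3 := by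
    have := pow_le_pow_left₀ (by positivity) hm4 3
    calc ℓ ^ 3 / 64 = (ℓ / 4) ^ 3 := by ring
      _ ≤ (m : ℝ) ^ 3 := this
  have hMA : M * A * ℓ ^ 2 ≤ c * ℓ ^ 3 / 128 := by
    have h1 : 128 * M * A ≤ c * ℓ := by
      rw [div_le_iff₀ hc] at hℓA
      linarith
    have h2 : 0 ≤ ℓ ^ 2 := by positivity
    nlinarith
  have hV : c * ℓ ^ 3 / 128 ≤ invPowSum 12 F - invPowSum 6 F := by
    rw [hS, hsplit]
    have h1 : c * (ℓ ^ 3 / 64) ≤ ((F.filter P).card : ℝ) * c := by nlinarith [hdeepN, hm3, hc.le]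
    have h2 : -(M * A * ℓ ^ 2) ≤ ((F.filter (fun z => ¬ P z)).card : ℝ) * (-M) := by nlinarith [hshallowN, hMpos.le]
    linarith
  have hVpos : 0 < invPowSum 12 F - invPowSum 6 F := lt_of_lt_of_le (by positivity) hV
  have h6nn : 0 ≤ invPowSum 6 F := by
    unfold invPowSum
    exact Finset.sum_nonneg fun y _ => Finset.sum_nonneg fun w _ => by positivity
  have h12pos : 0 < invPowSum 12 F := by linarith
  have hNB : (F.card : ℝ) ≤ B * ℓ ^ 3 := by
    have hbox := card_le_of_separated_of_box F (fun i => q i) (fun _ => ℓ) hδ (fun _ => hℓpos.le) hFcube hsepF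
    rw [Finset.prod_const, Finset.card_univ, Fintype.card_fin] at hbox
    have h3 : 2 * ℓ / δ + 1 ≤ 3 * ℓ / δ := by
      rw [div_add_one (ne_of_gt hδ), div_le_div_iff_of_pos_right hδ]
      linarith
    have h4 : (2 * ℓ / δ + 1) ^ 3 ≤ (3 * ℓ / δ) ^ 3 := pow_le_pow_left₀ (by positivity) h3 3
    calc (F.card : ℝ) ≤ (2 * ℓ / δ + 1) ^ 3 := hbox
      _ ≤ (3 * ℓ / δ) ^ 3 := h4
      _ = B * ℓ ^ 3 := by rw [hB]; field_simp; ring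
  have h12le : invPowSum 12 F ≤ Dd * ℓ ^ 3 := by
    calc invPowSum 12 F ≤ 250 * δ⁻¹ ^ 12 * (F.card : ℝ) := invPowSum_twelve_le hδ hsepF
      _ ≤ 250 * δ⁻¹ ^ 12 * (B * ℓ ^ 3) := mul_le_mul_of_nonneg_left hNB (by positivity)
      _ = Dd * ℓ ^ 3 := by rw [hDd]; ring
  refine ⟨ℓ, hℓ₀, q, F, hFcoe, ?_⟩
  unfold dilationGain
  rw [le_div_iff₀ (by positivity)]
  have h1 : κ * ℓ ^ 3 * (24 * invPowSum 12 F) ≤ κ * ℓ ^ 3 * (24 * (Dd * ℓ ^ 3)) :=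
    mul_le_mul_of_nonneg_left (by linarith) (by positivity)
  have h2 : κ * ℓ ^ 3 * (24 * (Dd * ℓ ^ 3)) = (c * ℓ ^ 3 / 128) ^ 2 := by
    rw [hκ]
    field_simp
    try ring
  have h3 : (c * ℓ ^ 3 / 128) ^ 2 ≤ (invPowSum 12 F - invPowSum 6 F) ^ 2 := pow_le_pow_left₀ (by positivity) hV 2
  linarith


/-- `LocalVirialLawT ⟹ CompressedVirialLaw`. [this file] -/
theorem compressedVirialLaw_of_localVirialLawT {T₀ D : ℝ} (h : LocalVirialLawT T₀ D) : CompressedVirialLaw T₀ D := by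
  obtain ⟨c, hc, τ₁, hτ₁, h⟩ := h
  exact compressedVirialLaw_of_localVirialT hc hτ₁ h

/-- **RDEF cone, ninth form with the DISCHARGED virial law in slot 3** (every `Λ`): `GrossCleanBallsU (1/250) 10 → ChargedEnergyGap →
LocalVirialLawT (1/250) 10 → TightDozenRigidity (1/250) → CleanCharted (1/250) 10 → DoorPeriodic Λ → BalancedLayeredClean Λ → CleanlessExcessT →
CoherentResidual 10 → RobustDefectLimitWindows`. [this file] -/
theorem rdef_of_grossU_doorPeriodic_discharged (Λ : ℝ) (hG : GrossCleanBallsU (1 / 250) 10) (hCEG : ChargedEnergyGap)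
    (hV : LocalVirialLawT (1 / 250) 10) (hK : TightDozenRigidity (1 / 250)) (h₂ : CleanCharted (1 / 250) 10) (hD : DoorPeriodic Λ)
    (hB : BalancedLayeredClean Λ) (hCE : CleanlessExcessT) (hR : CoherentResidual 10) : RobustDefectLimitWindows :=
  rdef_of_grossU_doorPeriodic_balanced Λ hG hCEG (compressedVirialLaw_of_localVirialLawT hV) hK h₂ hD hB hCE hR

end Summit.AtomisticToContinuum.Crystallization.Theorems.OverbindingBudgetLocalVirialTransfer
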